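import Mathlib
import Summits.ValiantsHypothesis.ValiantsHypothesis.Theorems.RigidityForcesSymmetryRankRigidMinimalReprLaplaceFiveSeparatedCaptureSliceRows

/-!
# K1 on `K₃ ⊔ K₂` when the three triangle short spans miss a common letter

K1 consumer (local bridge ✓ `sideSym_K32canon_of_captureAt`) of ✓ `captureIneqSym_of_four_letters` (`…SeparatedCaptureSliceRows`):
a side-symmetric split decomposition of `P₅` on the cuts `{01, 02, 12, 34}` whose three triangle short spans are supported on four
letters — some letter `c` occurs in no short matrix of the cuts `{0,1}`, `{0,2}`, `{1,2}` — has Laplace weight `≥ 5! = 120`.  No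
hypothesis on the finranks of the short spans or on the leaf cut.

Honest framing.  A POSITION sub-case of K1 on `K₃ ⊔ K₂`; K1 on `K₃ ⊔ K₂` in general (generic five-letter short spans),
`CaptureIneqSym`, `LaplaceOptimalFive` (OPEN · CONTESTED 72/120), `RankRigidMinimalRepr`, `VP ≠ VNP` are NOT proved.  No definitions,
no `sorry`.
-/

set_option linter.dupNamespace false
set_option autoImplicit false

namespace Summit.ValiantsHypothesis.ValiantsHypothesis.Theorems.RigidityForcesSymmetryRankRigidMinimalRepr

namespace LaplaceFiveSeparatedCapture

open Finset LaplaceFiveSectorSplit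

/-- ★★★ **K1 ON `K₃ ⊔ K₂` WHEN THE TRIANGLE SHORT SPANS MISS A LETTER**: if some letter `c` is touched by no short matrix of the three
triangle cuts (row `c` of every member of the joint short span vanishes), the Laplace weight is at least `5! = 120`. [folklore] -/
theorem sideSym_K32canon_four_letters {N : ℕ} (T : Finset (Fin N)) (S : Fin N → Finset (Fin 5))
    (u w : Fin N → (Fin 5 → Fin 5) → ℂ) (hdec : IsSplitDecomposition T S u w) (hsym : SideSymmetric T S u w)
    (hC : ∀ t ∈ T, S t = ({0, 1} : Finset (Fin 5)) ∨ S t = ({0, 2} : Finset (Fin 5)) ∨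
      S t = ({1, 2} : Finset (Fin 5)) ∨ S t = ({3, 4} : Finset (Fin 5)))
    (c d a b e : Fin 5) (hcov : ∀ x : Fin 5, x = c ∨ x = d ∨ x = a ∨ x = b ∨ x = e)
    (hmiss : ∀ x ∈ shortSpan T S u 0 1 ⊔ shortSpan T S u 0 2 ⊔ shortSpan T S u 1 2, ∀ q : Fin 5, x c q = 0) :
    Nat.factorial 5 ≤ laplaceWeight T S :=
  sideSym_K32canon_of_captureAt T S u w hdec hsym hC fun hs01 hs02 hs12 W hWs hWd hWc =>
    captureIneqSym_of_four_letters _ _ _ W hs01 hs02 hs12 c d a b e hcov hmiss hWs hWd hWc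

end LaplaceFiveSeparatedCapture

end Summit.ValiantsHypothesis.ValiantsHypothesis.Theorems.RigidityForcesSymmetryRankRigidMinimalRepr
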